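import Literature.Probability.Percolation.TwoGhostInequalityProofs
import Literature.Probability.Percolation.SharpnessDCTProofs
import HarnessLib

/-!
# Route PercMinContact — support `SwallowInequality` (stmt-CriticalPhenomena-11500), part 1:
# the truncated probe and its bookkeeping

Helper file (supports stmt-CriticalPhenomena-11500) for the swallow inequality
`θ(p_c) ≤ ∫_{(p,p_c)} (1-u)⁻¹ m(u) du`, `m(u) = E_u[Σ_{y ∼ 0} 1{0 ↮ y} min(|C(0)|, |C(y)|)]`, of bond
percolation on `ℤ^d` (used at `d = 3`). Contents (namespace `…Theorems.SwallowIneq`):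

* cluster surgery: opening a pair with no endpoint in `C(o)` does not change `C(o)`; with an
  endpoint in `C(o)` the new cluster is inside `C(o) ∪ C(b)` (`TwoGhost.union_openCluster_insert_eq_self`);
* the truncation events `A_k = sizeEvent d k = {k ≤ |C_{ω ∩ E}(0)|}` (increasing, antitone in `k`);
* the levels `P d u = P_{projIcc u}`, the edge labels `(v, i) ↦ {v, v + eᵢ}` of `Λ_N`
  (`labels`, `edgesN`), the truncated probe `fN d N u = N⁻¹ Σ_{k ≤ N} P_u(A_k)`
  (`= E_u[min(|C(0)|, N)]/N`), the pivotality events `pivEvent` and Russo's derivative `DN`;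
* the kernel count `cnt N c b = #{k ≤ N : c < k ≤ c + b}` with the KERNEL BOUND
  `c · cnt N c b ≤ N · min(c, b)` (`mul_cnt_le`) — the unfactorised merger kernel of the probe;
* measurability of `ω ↦ |C_ω(x)| ∈ ℕ∞` through the finite-cluster data `TwoGhost.cdata`, translation
  covariance of cluster sizes, the transported summands `hfun`, `Hfun`, the min-contact function
  `mfun d u = m(u)` (stated verbatim as in the route item), neighbour sums at the origin and the
  almost sure lattice support of `P_u`.

Part 2 is `PercMinContactSwallowInequalityTransport.lean`, the assembly `PercMinContactSwallowInequality.lean`.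
Sources: Grimmett, *Percolation* (1999) §2.4, §5.3 (Lemma (5.51), the factorised ancestor);
Aizenman–Barsky (1987); Hutchcroft, Ann. Probab. 48 (2020) §2–3 (mass transport, resampling one edge).
-/

noncomputable section

namespace Summit.CriticalPhenomena.PercolationContinuityZ3.Theorems

open MeasureTheory Filter Literature.Probability.Percolation Literature.Probability.LatticeModels
open scoped Topology ENNReal

namespace SwallowIneq

/-! ### Cluster surgery: opening one edge -/

section Surgery

variable {V : Type*}

/-- If neither endpoint of the pair `{a, b}` lies in `C_ω(o)`, opening `{a, b}` does not change
`C(o)`. -/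
theorem openCluster_insert_eq_of_notMem {ω : BondConfig V} {o a b : V}
    (ha : a ∉ openCluster ω o) (hb : b ∉ openCluster ω o) :
    openCluster (insert s(a, b) ω) o = openCluster ω o := by
  refine Set.Subset.antisymm ?_ (openCluster_mono (Set.subset_insert _ _) o)
  refine TwoGhost.openCluster_subset_of_closed (mem_openCluster_self _ _) ?_
  intro x hx y hxy
  rw [openGraph_adj] at hxy
  obtain ⟨hmem, hne⟩ := hxy
  rcases Set.mem_insert_iff.1 hmem with h | h
  · exfalso
    have hx' : x ∈ s(a, b) := by rw [← h]; exact Sym2.mem_mk_left x y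
    rcases Sym2.mem_iff.1 hx' with rfl | rfl
    · exact ha hx
    · exact hb hx
  · exact SimpleGraph.Reachable.trans hx ((openGraph_adj ω x y).2 ⟨h, hne⟩).reachable

/-- If `a ∈ C_ω(o)`, then after opening `{a, b}` the cluster of `o` is contained in
`C_ω(o) ∪ C_ω(b)`. -/
theorem openCluster_insert_subset_union {ω : BondConfig V} {o a b : V}
    (ha : a ∈ openCluster ω o) :
    openCluster (insert s(a, b) ω) o ⊆ openCluster ω o ∪ openCluster ω b := by
  have h1 : openCluster (insert s(a, b) ω) o = openCluster (insert s(a, b) ω) a := by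
    have : a ∈ openCluster (insert s(a, b) ω) o := openCluster_mono (Set.subset_insert _ _) o ha
    exact (TwoGhost.openCluster_eq_of_mem this).symm
  have h2 : openCluster ω o = openCluster ω a := (TwoGhost.openCluster_eq_of_mem ha).symm
  rw [h1, h2, ← TwoGhost.union_openCluster_insert_eq_self ω a b]
  exact Set.subset_union_left

end Surgery

/-! ### The truncation events `A_k = {|C(0)| ≥ k}` (clusters of the lattice edges of `ω`) -/

section Events

variable {d : ℕ}

/-- The lattice part `ω ∩ E(ℤ^d)` of a configuration. -/
def latt (ω : BondConfig (Site d)) : BondConfig (Site d) := ω ∩ (zdGraph d).edgeSet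

/-- `latt ω ⊆ E(ℤ^d)`. -/
theorem latt_subset (ω : BondConfig (Site d)) : latt ω ⊆ (zdGraph d).edgeSet :=
  Set.inter_subset_right

/-- `latt ω = ω` for a lattice configuration. -/
theorem latt_eq_of_subset {ω : BondConfig (Site d)} (h : ω ⊆ (zdGraph d).edgeSet) : latt ω = ω :=
  Set.inter_eq_left.2 h

/-- `latt` is monotone. -/
theorem latt_mono {ω ω' : BondConfig (Site d)} (h : ω ⊆ ω') : latt ω ⊆ latt ω' :=
  Set.inter_subset_inter_left _ h

/-- The truncation event `A_k = {k ≤ |C(0)|}`, the cluster being computed with the lattice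
edges of the configuration only (so that the event is local). -/
def sizeEvent (d k : ℕ) : Set (BondConfig (Site d)) :=
  {ω | (k : ℕ∞) ≤ (openCluster (latt ω) 0).encard}

/-- Membership in `A_k`. -/
theorem mem_sizeEvent {k : ℕ} {ω : BondConfig (Site d)} :
    ω ∈ sizeEvent d k ↔ (k : ℕ∞) ≤ (openCluster (latt ω) 0).encard := Iff.rfl

/-- `A_k` is increasing. -/
theorem isUpperSet_sizeEvent (d k : ℕ) : IsUpperSet (sizeEvent d k) := by
  intro ω ω' h hω
  rw [mem_sizeEvent] at hω ⊢
  exact hω.trans (Set.encard_le_encard (openCluster_mono (latt_mono h) 0))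

/-- `A_k` is decreasing in `k`. -/
theorem sizeEvent_antitone (d : ℕ) : Antitone (sizeEvent d) := by
  intro k k' h ω hω
  rw [mem_sizeEvent] at hω ⊢
  exact le_trans (by exact_mod_cast h) hω

/-- `A_0` is the sure event. -/
theorem sizeEvent_zero (d : ℕ) : sizeEvent d 0 = Set.univ := by
  ext ω; simp [mem_sizeEvent]

end Events

/-! ### The levels, the edge labels, the truncated probe and Russo's derivative -/

section Probe

variable {d : ℕ}

/-- `P_u`: bond percolation on `ℤ^d` at the clamped level `projIcc u`. -/
def P (d : ℕ) (u : ℝ) : Measure (BondConfig (Site d)) :=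
  bondPercolation (zdGraph d) (Set.projIcc 0 1 zero_le_one u)

/-- `P_u` is a probability measure. -/
instance instIsProbabilityMeasureP (d : ℕ) (u : ℝ) : IsProbabilityMeasure (P d u) := by
  unfold P; infer_instance

/-- `Set.sym2` is monotone. -/
theorem sym2_subset_sym2 {α : Type*} {s t : Set α} (h : s ⊆ t) : s.sym2 ⊆ t.sym2 := by
  intro e he
  induction e using Sym2.ind with
  | h a b =>
    rw [Set.mk_mem_sym2_iff] at he ⊢
    exact ⟨h he.1, h he.2⟩

/-- The edge labels `(v, i)` (edge `{v, v + eᵢ}`) with `v ∈ Λ_N`. -/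
def labels (d N : ℕ) : Finset (Site d × Fin d) := box d N ×ˢ Finset.univ

/-- The edges `{v, v + eᵢ}`, `v ∈ Λ_N`: a finite set of lattice edges containing all edges with
both endpoints in `Λ_N`. -/
def edgesN (d N : ℕ) : Finset (Sym2 (Site d)) := (labels d N).image TwoGhost.edgeOf

/-- Edges of `edgesN` are lattice edges. -/
theorem edgesN_subset_edgeSet {N : ℕ} {e : Sym2 (Site d)} (he : e ∈ edgesN d N) :
    e ∈ (zdGraph d).edgeSet := by
  obtain ⟨ℓ, -, rfl⟩ := Finset.mem_image.1 he
  exact TwoGhost.edgeOf_mem_edgeSet ℓ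

/-- Lattice edges with both endpoints in `Λ_N` belong to `edgesN d N`. -/
theorem mem_edgesN_of_mem_sym2 {N : ℕ} {e : Sym2 (Site d)} (he : e ∈ (zdGraph d).edgeSet)
    (hbox : e ∈ ((box d N : Finset (Site d)) : Set (Site d)).sym2) : e ∈ edgesN d N := by
  induction e using Sym2.ind with
  | h a b =>
    rw [Set.mk_mem_sym2_iff] at hbox
    rw [SimpleGraph.mem_edgeSet, zdGraph_adj_iff] at he
    obtain ⟨i, h | h⟩ := he
    · refine Finset.mem_image.2 ⟨(a, i), Finset.mem_product.2 ⟨hbox.1, Finset.mem_univ _⟩, ?_⟩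
      rw [TwoGhost.edgeOf, h]
    · refine Finset.mem_image.2 ⟨(b, i), Finset.mem_product.2 ⟨hbox.2, Finset.mem_univ _⟩, ?_⟩
      rw [TwoGhost.edgeOf, ← h, Sym2.eq_swap]

/-- The truncated probe `f_N(u) = N⁻¹ Σ_{k=1}^{N} P_u(A_k) = E_u[min(|C(0)|, N)/N]`. -/
def fN (d N : ℕ) (u : ℝ) : ℝ := (N : ℝ)⁻¹ * ∑ k ∈ Finset.Icc 1 N, (P d u).real (sizeEvent d k)

/-- The event that `e` is pivotal for `A_k`. -/
def pivEvent (d k : ℕ) (e : Sym2 (Site d)) : Set (BondConfig (Site d)) :=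
  {ω | IsPivotal (sizeEvent d k) e ω}

/-- Russo's derivative `D_N(u) = N⁻¹ Σ_{k ≤ N} Σ_{e} P_u(e pivotal for A_k)`. -/
def DN (d N : ℕ) (u : ℝ) : ℝ :=
  (N : ℝ)⁻¹ * ∑ k ∈ Finset.Icc 1 N, ∑ e ∈ edgesN d N, (P d u).real (pivEvent d k e)

/-- `D_N ≥ 0`. -/
theorem DN_nonneg (d N : ℕ) (u : ℝ) : 0 ≤ DN d N u :=
  mul_nonneg (inv_nonneg.2 (Nat.cast_nonneg N))
    (Finset.sum_nonneg fun _ _ => Finset.sum_nonneg fun _ _ => measureReal_nonneg)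

/-- The a.s. support of `P_u`: lattice configurations. -/
theorem ae_subset_edgeSet (u : ℝ) : ∀ᵐ ω ∂(P d u), ω ⊆ (zdGraph d).edgeSet := by
  unfold P bondPercolation
  exact ProbabilityTheory.setBernoulli_ae_subset

end Probe

/-! ### The kernel count `#{k ≤ N : c < k ≤ c + b}` -/

section Kernel

/-- `cnt N c b = #{k ∈ [1, N] : c < k ≤ c + b}` in `ℝ≥0∞` (`c, b ∈ ℕ∞`): the number of truncation
levels at which merging a cluster of size `c` with one of size `b` is pivotal. -/
def cnt (N : ℕ) (c b : ℕ∞) : ℝ≥0∞ :=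
  ∑ k ∈ Finset.Icc 1 N, if c < k ∧ (k : ℕ∞) ≤ c + b then 1 else 0

/-- `cnt ≤ N`. -/
theorem cnt_le_N (N : ℕ) (c b : ℕ∞) : cnt N c b ≤ N := by
  unfold cnt
  calc (∑ k ∈ Finset.Icc 1 N, if c < k ∧ (k : ℕ∞) ≤ c + b then (1 : ℝ≥0∞) else 0)
      ≤ ∑ _k ∈ Finset.Icc 1 N, (1 : ℝ≥0∞) := Finset.sum_le_sum fun k _ => by split_ifs <;> simp
    _ = N := by simp

/-- `cnt ≤ b`. -/
theorem cnt_le_right (N : ℕ) (c b : ℕ∞) : cnt N c b ≤ (b : ℝ≥0∞) := by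
  induction c using ENat.recTopCoe with
  | top =>
    have : cnt N ⊤ b = 0 := Finset.sum_eq_zero fun k _ => by rw [if_neg]; simp
    rw [this]; exact bot_le
  | coe m =>
    induction b using ENat.recTopCoe with
    | top => simp
    | coe n =>
      unfold cnt
      rw [Finset.sum_boole]
      have hsub : ((Finset.Icc 1 N).filter (fun k : ℕ => (m : ℕ∞) < k ∧ (k : ℕ∞) ≤ m + n)) ⊆
          Finset.Ioc m (m + n) := by
        intro k hk
        rw [Finset.mem_filter] at hk
        rw [Finset.mem_Ioc]
        obtain ⟨-, h1, h2⟩ := hk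
        exact ⟨by exact_mod_cast h1, by exact_mod_cast h2⟩
      calc ((((Finset.Icc 1 N).filter (fun k : ℕ => (m : ℕ∞) < k ∧ (k : ℕ∞) ≤ m + n)).card : ℕ) : ℝ≥0∞)
          ≤ ((Finset.Ioc m (m + n)).card : ℝ≥0∞) := by exact_mod_cast Finset.card_le_card hsub
        _ = ((n : ℕ∞) : ℝ≥0∞) := by simp

/-- `cnt = 0` when `c ≥ N`. -/
theorem cnt_eq_zero_of_le {N : ℕ} {c : ℕ∞} (b : ℕ∞) (h : (N : ℕ∞) ≤ c) : cnt N c b = 0 := by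
  refine Finset.sum_eq_zero fun k hk => ?_
  rw [if_neg]
  rintro ⟨h1, -⟩
  have h2 : (k : ℕ∞) ≤ N := by exact_mod_cast (Finset.mem_Icc.1 hk).2
  exact absurd (h1.trans_le (h2.trans h)) (lt_irrefl _)

/-- **The kernel bound** `c · #{k ≤ N : c < k ≤ c + b} ≤ N · min(c, b)` (the unfactorised
merger kernel of the truncated probe is at most `min`). -/
theorem mul_cnt_le (N : ℕ) (c b : ℕ∞) :
    (c : ℝ≥0∞) * cnt N c b ≤ N * min (c : ℝ≥0∞) (b : ℝ≥0∞) := by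
  by_cases hc : (N : ℕ∞) ≤ c
  · rw [cnt_eq_zero_of_le b hc, mul_zero]; exact bot_le
  · rw [not_le] at hc
    have hcN : (c : ℝ≥0∞) ≤ N := by
      have := ENat.toENNReal_le.2 hc.le
      simpa using this
    rcases le_total (c : ℝ≥0∞) (b : ℝ≥0∞) with h | h
    · rw [min_eq_left h, mul_comm (N : ℝ≥0∞)]
      exact mul_le_mul_right (cnt_le_N N c b) _
    · rw [min_eq_right h]
      exact mul_le_mul' hcN (cnt_le_right N c b)

end Kernel

/-! ### Cluster-size statistics: measurability and translation covariance -/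

section Stats

variable {d : ℕ}

/-- The size of a cluster read off its finite-cluster data. -/
def csize (c : TwoGhost.CData (Site d)) : ℕ∞ :=
  match c.val with
  | none => ⊤
  | some p => (p.1.card : ℕ∞)

/-- `|C(x)| = csize (cdata ω x)`. -/
theorem encard_eq_csize (ω : BondConfig (Site d)) (x : Site d) :
    (openCluster ω x).encard = csize (TwoGhost.cdata (zdGraph d) ω x) := by
  by_cases hf : (openCluster ω x).Finite
  · rw [TwoGhost.cdata_of_finite hf]
    simp only [csize]
    rw [hf.encard_eq_coe_toFinset_card]
  · rw [TwoGhost.cdata_of_infinite hf]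
    simp only [csize]
    exact Set.Infinite.encard_eq hf

/-- `ω ↦ |C_ω(x)|` is measurable. -/
theorem measurable_encard (x : Site d) :
    Measurable fun ω : BondConfig (Site d) => (openCluster ω x).encard := by
  have : (fun ω : BondConfig (Site d) => (openCluster ω x).encard) =
      fun ω => csize (TwoGhost.cdata (zdGraph d) ω x) := funext fun ω => encard_eq_csize ω x
  rw [this]
  exact TwoGhost.measurable_comp_cdata (G := zdGraph d) x csize

/-- `ω ↦ |C_ω(x)|` is measurable as an `ℝ≥0∞`-valued function. -/
theorem measurable_encard_ennreal (x : Site d) :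
    Measurable fun ω : BondConfig (Site d) => ((openCluster ω x).encard : ℝ≥0∞) :=
  (measurable_of_countable fun n : ℕ∞ => (n : ℝ≥0∞)).comp (measurable_encard x)

/-- `ω ↦ cnt N |C(0)| |C(y)|` is measurable. -/
theorem measurable_cnt (N : ℕ) (y : Site d) :
    Measurable fun ω : BondConfig (Site d) => cnt N (openCluster ω 0).encard (openCluster ω y).encard := by
  have h : Measurable fun ω : BondConfig (Site d) =>
      ((openCluster ω 0).encard, (openCluster ω y).encard) :=
    (measurable_encard 0).prodMk (measurable_encard y)
  exact (measurable_of_countable (fun p : ℕ∞ × ℕ∞ => cnt N p.1 p.2)).comp h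

/-- `|C_{ω+u}(x + u)| = |C_ω(x)|`. -/
theorem encard_openCluster_shiftConfig (u : Site d) (ω : BondConfig (Site d)) (x : Site d) :
    (openCluster (TwoGhost.shiftConfig u ω) (x + u)).encard = (openCluster ω x).encard := by
  rw [TwoGhost.openCluster_shiftConfig]
  exact (add_left_injective u).encard_image _

open Classical in
/-- `Σ_v 1{v ∈ C} = |C|` in `ℝ≥0∞`. -/
theorem tsum_ite_mem_eq_encard (C : Set (Site d)) :
    ∑' v : Site d, (if v ∈ C then (1 : ℝ≥0∞) else 0) = C.encard := by
  classical
  have : (fun v => if v ∈ C then (1 : ℝ≥0∞) else 0) = C.indicator 1 := by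
    funext v; simp only [Set.indicator_apply, Pi.one_apply]
  rw [this, ← tsum_subtype C (1 : Site d → ℝ≥0∞)]
  exact ENNReal.tsum_set_one C

/-- Sums over the neighbours of the origin: `Σ_{y ∼ 0} f(y) = Σ_i (f(eᵢ) + f(-eᵢ))`. -/
theorem sum_neighborFinset_zero (f : Site d → ℝ≥0∞) :
    ∑ y ∈ (zdGraph d).neighborFinset (0 : Site d), f y =
      ∑ i : Fin d, (f (Pi.single i 1) + f (-Pi.single i 1)) := by
  classical
  rw [neighborFinset_zdGraph_eq_image, Finset.sum_image]
  · rw [Fintype.sum_prod_type]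
    refine Finset.sum_congr rfl fun i _ => ?_
    rw [Fintype.sum_bool]
    simp only [if_true, zero_add, Bool.false_eq_true, if_false, Pi.single_neg]
  · intro p _ q _ h
    exact single_signedUnit_injective (add_left_cancel h)

end Stats

/-! ### The transported summands and the min-contact function -/

section Summands

variable {d : ℕ}

open Classical in
/-- `h_N(x, y, ω) = 1{x ∈ C(0), y ∉ C(0)} · cnt_N(|C(0)|, |C(y)|)`. -/
def hfun (N : ℕ) (x y : Site d) (ω : BondConfig (Site d)) : ℝ≥0∞ :=
  if x ∈ openCluster ω 0 ∧ y ∉ openCluster ω 0 then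
    cnt N (openCluster ω 0).encard (openCluster ω y).encard else 0

open Classical in
/-- `H_N(y, ω) = 1{y ∉ C(0)} · cnt_N(|C(0)|, |C(y)|)`. -/
def Hfun (N : ℕ) (y : Site d) (ω : BondConfig (Site d)) : ℝ≥0∞ :=
  if y ∉ openCluster ω 0 then cnt N (openCluster ω 0).encard (openCluster ω y).encard else 0

/-- The min-contact function `m(u) = E_u[Σ_{y ∼ 0} 1{0 ↮ y} min(|C(0)|, |C(y)|)]` (values in
`[0, ∞]`). -/
def mfun (d : ℕ) (u : ℝ) : ℝ≥0∞ :=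
  ∫⁻ ω, ∑ y ∈ (zdGraph d).neighborFinset (0 : Site d),
    (openConn (0 : Site d) y)ᶜ.indicator
      (fun ω => min ((openCluster ω 0).encard : ℝ≥0∞) ((openCluster ω y).encard : ℝ≥0∞)) ω ∂(P d u)

open Classical in
/-- `h_N` as a sum over the truncation levels. -/
theorem hfun_eq_sum (N : ℕ) (x y : Site d) (ω : BondConfig (Site d)) :
    hfun N x y ω = ∑ k ∈ Finset.Icc 1 N,
      if x ∈ openCluster ω 0 ∧ y ∉ openCluster ω 0 ∧ (openCluster ω 0).encard < k ∧
        (k : ℕ∞) ≤ (openCluster ω 0).encard + (openCluster ω y).encard then 1 else 0 := by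
  unfold hfun cnt
  by_cases h : x ∈ openCluster ω 0 ∧ y ∉ openCluster ω 0
  · rw [if_pos h]
    refine Finset.sum_congr rfl fun k _ => ?_
    by_cases h' : (openCluster ω 0).encard < k ∧ (k : ℕ∞) ≤ (openCluster ω 0).encard + (openCluster ω y).encard
    · rw [if_pos h', if_pos ⟨h.1, h.2, h'.1, h'.2⟩]
    · rw [if_neg h', if_neg (fun h'' => h' ⟨h''.2.2.1, h''.2.2.2⟩)]
  · rw [if_neg h]
    symm
    refine Finset.sum_eq_zero fun k _ => if_neg ?_
    exact fun h' => h ⟨h'.1, h'.2.1⟩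

/-- `h_N(x, y, ·)` is measurable. -/
theorem measurable_hfun (N : ℕ) (x y : Site d) :
    Measurable (hfun N x y : BondConfig (Site d) → ℝ≥0∞) := by
  unfold hfun
  refine Measurable.ite ?_ (measurable_cnt N y) measurable_const
  exact (TwoGhost.measurableSet_mem_openCluster 0 x).inter (TwoGhost.measurableSet_mem_openCluster 0 y).compl

/-- `H_N(y, ·)` is measurable. -/
theorem measurable_Hfun (N : ℕ) (y : Site d) : Measurable (Hfun N y : BondConfig (Site d) → ℝ≥0∞) := by
  unfold Hfun
  exact Measurable.ite (TwoGhost.measurableSet_mem_openCluster 0 y).compl (measurable_cnt N y) measurable_const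

end Summands

end SwallowIneq

end Summit.CriticalPhenomena.PercolationContinuityZ3.Theorems
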